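import Mathlib.Analysis.SpecialFunctions.Trigonometric.InverseDeriv
import Mathlib.Analysis.SpecialFunctions.Integrals.Basic
import Mathlib.MeasureTheory.Function.JacobianOneDim
import Literature.Barriers.QuantumFields.GrossWittenCoulombGas
import HarnessLib

/-!
# The Gross–Witten equilibrium measures: explicit Frostman data in both phases

Sibling proof file of `GrossWittenTransition.lean` (`Literature/Barriers/QuantumFields/`, D-0021;
namespace `Literature.Barriers.QuantumFields`), layer 3 of the discharge of the named fact
`GrossWittenLargeNFreeEnergy` (Johansson 1998, Lemma 2.1): for every `γ ≥ 0` we INHABIT the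
hypothesis structure `GWFrostmanData γ` of `GrossWittenCoulombGas.lean` by the Gross–Witten
equilibrium measures and compute their free energies,

* `0 ≤ γ ≤ 1` (`strongData`): the density `(2π)⁻¹(1 + γ cos t)` on the whole circle
  (Johansson's Lemma 3.2 (i)), density bound `(1+γ)/(2π)`, logarithmic potential `−(γ/2) cos`
  (so the effective potential `γ cos + 2U` VANISHES identically: `ℓ_F = 0`), first moment `γ/2`,
  energy `−γ²/4`, free energy `γ²/2 − γ²/4 = γ²/4 = gwStrong γ` (`strongData_freeEnergy`);
* `γ > 1` (`weakData`): the gapped measure of Johansson's Lemma 3.2 (ii),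
  `π⁻¹ γ cos(t/2) √(1/γ − sin²(t/2)) χ_{[-t_c,t_c]} dt`, realised WITHOUT writing that density as the
  push-forward `T_* ((2π)⁻¹(1 + cos β) dβ)` of the critical density under
  `T(β) = 2 arcsin (a sin (β/2))`, `a = γ^{-1/2}` (so `sin (T/2) = a sin (β/2)`,
  `cos T = 1 − a² + a² cos β`): density bound `(π a)⁻¹ = √γ/π` by the one-dimensional change of
  variables (`weakMeasure_le_smul`), first moment `∫cos dμ* = 1 − 1/(2γ)` (Johansson's (3.8),
  `integral_cos_weakMeasure`), Frostman constant `ℓ_F = γ − 1 − log γ` with EQUALITY on the arc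
  (`frostman_eq_inside`) and strict inequality off it (`frostman_le_outside`, via `x ≤ sinh x`),
  energy `2E = −log γ − 1/2`, free energy `γ − 3/4 − (log γ)/2 = gwWeak γ`
  (`weakData_freeEnergy`).

With `GWFrostmanData.tendsto_gwFreeEnergyN` this gives Lemma 2.1 in both phases; the one-line
assembly `GrossWittenLargeNFreeEnergy_holds` is in `GrossWittenTransitionProofs.lean`.

## Method (all [folklore]; the two densities are [cite: Johansson1998, Lemma 3.2])

Everything is computed on the `β`-side against the critical density `w = (2π)⁻¹(1 + cos β)`:
`∫ g dμ* = ∫ g(Tβ) w(β) dβ` (`integral_weakMeasure`); the symmetrised kernel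
`ℓ(t − Tβ) + ℓ(t + Tβ) = log (2|cos t − cos Tβ|) = log (2a²|cos β − c|)`, `c = 1 + γ(cos t − 1)`
(`two_mul_circleLogPotential_weakMeasure`), integrates against `w` to `log a² − c` when
`|c| ≤ 1` (`integral_log_inside`: `c = cos β₀`, `log (2|cos β − cos β₀|) = ℓ(β−β₀) + ℓ(β+β₀)` a.e.,
then the first Fourier moments `∫ℓ = 0`, `∫ℓ cos = −π` of `CircleLogKernel.lean`) and to
`log a² + ρ − log ρ` when `c < −1` (`integral_log_outside`: Joukowski `−c = (ρ+ρ⁻¹)/2`,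
`log (−c + cos β) = 2ℓ_ρ(β+π) − log 2ρ`). Integrability of `β ↦ ℓ(t − Tβ) w(β)` is transported from
the `μ*`-integrability of `ℓ(t − ·)` (dominated measure) through `map`/`withDensity`, so the
critical points of `T` never need to be analysed.

## References

* K. Johansson, *The longest increasing subsequence in a random permutation and a unitary random
  matrix model*, Math. Res. Lett. 5 (1998) 63–82 — Lemma 2.1 (p. 66), Lemma 3.2 and (3.8) (p. 71).
* D. J. Gross, E. Witten, Phys. Rev. D 21 (1980) 446–453 (the original steepest-descent solution).
-/

noncomputable section

open MeasureTheory Filter Set Complex intervalIntegral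
open scoped Topology Real ENNReal NNReal

namespace Literature.Barriers.QuantumFields

open Literature.Analysis.Potential

/-! ### Trigonometric densities `a + b cos` on a period -/

/-- The density `t ↦ a + b cos t` (as an `ℝ≥0∞`-valued function). [folklore] -/
def trigDensity (a b : ℝ) (t : ℝ) : ℝ≥0∞ := ENNReal.ofReal (a + b * Real.cos t)

/-- The measure `(a + b cos t) dt` on `[-π, π]`. For `a = 1/(2π)`, `b = γ/(2π)`, `0 ≤ γ ≤ 1` this is
the Gross–Witten strong-coupling equilibrium measure `(2π)⁻¹(1 + γ cos t) dt` (Johansson's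
Lemma 3.2 (i) density `(2π)⁻¹(1 + ξ cos t)`); for `a = b = 1/(2π)` the critical one.
[cite: Johansson1998, Lemma 3.2 (i)] -/
def trigMeasure (a b : ℝ) : Measure ℝ := (volume.restrict (Icc (-π) π)).withDensity (trigDensity a b)

/-- `trigDensity` is measurable. [folklore] -/
@[fun_prop] theorem measurable_trigDensity (a b : ℝ) : Measurable (trigDensity a b) := by
  unfold trigDensity; fun_prop

/-- For `|b| ≤ a` the density is non-negative: `0 ≤ a + b cos t`. [folklore] -/
theorem trigDensity_arg_nonneg {a b : ℝ} (hab : |b| ≤ a) (t : ℝ) : 0 ≤ a + b * Real.cos t := by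
  have h1 : |b * Real.cos t| ≤ a := by
    rw [abs_mul]
    exact (mul_le_of_le_one_right (abs_nonneg b) (Real.abs_cos_le_one t)).trans hab
  have := neg_abs_le (b * Real.cos t)
  linarith

/-- `trigMeasure a b ≤ (a + |b|) · vol|[-π,π]`. [folklore] -/
theorem trigMeasure_le_smul (a b : ℝ) :
    trigMeasure a b ≤ ENNReal.ofReal (a + |b|) • volume.restrict (Icc (-π) π) := by
  rw [trigMeasure, ← withDensity_const]
  refine withDensity_mono (ae_of_all _ fun t => ?_)
  unfold trigDensity
  refine ENNReal.ofReal_le_ofReal ?_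
  have := le_abs_self (b * Real.cos t)
  have h1 : |b * Real.cos t| ≤ |b| := by
    rw [abs_mul]; exact mul_le_of_le_one_right (abs_nonneg b) (Real.abs_cos_le_one t)
  linarith

/-- `trigMeasure` is a finite measure. [folklore] -/
instance isFiniteMeasure_trigMeasure (a b : ℝ) : IsFiniteMeasure (trigMeasure a b) :=
  isFiniteMeasure_of_le_smul (trigMeasure_le_smul a b)

/-- **Integration against a trigonometric density**: for `|b| ≤ a` and measurable `g`,
`∫ g d(trigMeasure a b) = ∫_{-π}^{π} g(t) (a + b cos t) dt` (no measurability needed: both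
sides are Bochner integrals with the same junk convention). [folklore] -/
theorem integral_trigMeasure {a b : ℝ} (hab : |b| ≤ a) (g : ℝ → ℝ) :
    ∫ t, g t ∂(trigMeasure a b) = ∫ t in (-π)..π, g t * (a + b * Real.cos t) := by
  rw [trigMeasure, integral_withDensity_eq_integral_toReal_smul (measurable_trigDensity a b)
    (ae_of_all _ fun t => by unfold trigDensity; exact ENNReal.ofReal_lt_top),
    integral_Icc_eq_integral_Ioc, ← intervalIntegral.integral_of_le (by linarith [Real.pi_pos])]
  refine intervalIntegral.integral_congr fun t _ => ?_
  simp only [trigDensity, smul_eq_mul]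
  rw [ENNReal.toReal_ofReal (trigDensity_arg_nonneg hab t), mul_comm]

/-- `∫_{-π}^{π} cos² = π`. [folklore] -/
theorem integral_cos_sq_period : ∫ t in (-π)..π, Real.cos t ^ 2 = π := by
  rw [integral_cos_sq]; simp

/-- Total mass: `∫_{-π}^{π} (a + b cos t) dt = 2π a`. [folklore] -/
theorem integral_trigDensity_arg (a b : ℝ) : ∫ t in (-π)..π, (a + b * Real.cos t) = 2 * π * a := by
  rw [intervalIntegral.integral_add intervalIntegrable_const (by apply Continuous.intervalIntegrable; fun_prop),
    intervalIntegral.integral_const_mul, integral_cos, intervalIntegral.integral_const]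
  simp only [smul_eq_mul, Real.sin_pi, Real.sin_neg, neg_zero, sub_zero, mul_zero, add_zero]
  ring

/-- First moment: `∫_{-π}^{π} cos t (a + b cos t) dt = π b`. [folklore] -/
theorem integral_cos_mul_trigDensity_arg (a b : ℝ) :
    ∫ t in (-π)..π, Real.cos t * (a + b * Real.cos t) = π * b := by
  have h : ∀ t, Real.cos t * (a + b * Real.cos t) = a * Real.cos t + b * Real.cos t ^ 2 := fun t => by ring
  simp_rw [h]
  rw [intervalIntegral.integral_add (by apply Continuous.intervalIntegrable; fun_prop)
    (by apply Continuous.intervalIntegrable; fun_prop),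
    intervalIntegral.integral_const_mul, intervalIntegral.integral_const_mul, integral_cos,
    integral_cos_sq_period]
  simp; ring

/-- For `|b| ≤ 1/(2π)`, `trigMeasure (1/(2π)) b` is a probability measure. [folklore] -/
theorem isProbabilityMeasure_trigMeasure {b : ℝ} (hb : |b| ≤ 1 / (2 * π)) :
    IsProbabilityMeasure (trigMeasure (1 / (2 * π)) b) := by
  constructor
  have h := integral_trigMeasure hb (fun _ => (1 : ℝ))
  simp only [one_mul, MeasureTheory.integral_const, smul_eq_mul, mul_one] at h
  rw [integral_trigDensity_arg] at h
  have h1 : (trigMeasure (1 / (2 * π)) b).real univ = 1 := by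
    rw [h]; field_simp
  rw [measureReal_def] at h1
  exact (ENNReal.toReal_eq_one_iff _).1 h1

/-- **Potential of a trigonometric density**: `U^{trigMeasure a b}(t) = −π b cos t` (for `|b| ≤ a`),
from `∫ ℓ(t − s)(a + b cos s) ds = −π b cos t` (`integral_circleLogKernel_sub_mul`). In particular the
logarithmic potential of the Gross–Witten strong-coupling density `(2π)⁻¹(1 + γ cos)` is
`−(γ/2) cos`. [folklore] -/
theorem circleLogPotential_trigMeasure {a b : ℝ} (hab : |b| ≤ a) (t : ℝ) :
    circleLogPotential (trigMeasure a b) t = -π * b * Real.cos t := by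
  rw [circleLogPotential, integral_trigMeasure hab, integral_circleLogKernel_sub_mul]

/-- First moment of a trigonometric probability density: `∫ cos d(trigMeasure a b) = π b`. [folklore] -/
theorem integral_cos_trigMeasure {a b : ℝ} (hab : |b| ≤ a) :
    ∫ t, Real.cos t ∂(trigMeasure a b) = π * b := by
  rw [integral_trigMeasure hab, integral_cos_mul_trigDensity_arg]

/-- Energy of a trigonometric density: `E(trigMeasure a b) = −π² b²`. [folklore] -/
theorem circleLogEnergy_trigMeasure {a b : ℝ} (hab : |b| ≤ a) :
    circleLogEnergy (trigMeasure a b) = -π ^ 2 * b ^ 2 := by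
  rw [circleLogEnergy]
  simp_rw [circleLogPotential_trigMeasure hab]
  rw [integral_trigMeasure hab]
  have h : ∀ t, -π * b * Real.cos t * (a + b * Real.cos t) =
      (-π * b) * (Real.cos t * (a + b * Real.cos t)) := fun t => by ring
  simp_rw [h]
  rw [intervalIntegral.integral_const_mul, integral_cos_mul_trigDensity_arg]; ring

/-! ### The strong-coupling phase `0 ≤ γ ≤ 1` -/

/-- **Frostman data in the strong-coupling phase** `0 ≤ γ ≤ 1`: the Gross–Witten density
`(2π)⁻¹(1 + γ cos t)` on the whole circle, density bound `(1+γ)/(2π)`, potential `−(γ/2) cos`, so the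
effective potential `γ cos + 2U ≡ 0 = ℓ_F` (Frostman with EQUALITY everywhere: full support).
[cite: Johansson1998, Lemma 3.2 (i)] -/
def strongData {γ : ℝ} (h0 : 0 ≤ γ) (h1 : γ ≤ 1) : GWFrostmanData γ where
  μ := trigMeasure (1 / (2 * π)) (γ / (2 * π))
  isProb := isProbabilityMeasure_trigMeasure (by
    rw [abs_of_nonneg (by positivity)]
    exact div_le_div_of_nonneg_right h1 (by positivity))
  M := 1 / (2 * π) + |γ / (2 * π)|
  le_smul := trigMeasure_le_smul _ _
  ℓF := 0
  frostman_le := fun t => by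
    rw [circleLogPotential_trigMeasure (by
      rw [abs_of_nonneg (by positivity)]
      exact div_le_div_of_nonneg_right h1 (by positivity))]
    have : γ * Real.cos t + 2 * (-π * (γ / (2 * π)) * Real.cos t) = 0 := by field_simp; ring
    rw [this]
  frostman_eq := by
    have hab : |γ / (2 * π)| ≤ 1 / (2 * π) := by
      rw [abs_of_nonneg (by positivity)]
      exact div_le_div_of_nonneg_right h1 (by positivity)
    rw [integral_cos_trigMeasure hab, circleLogEnergy_trigMeasure hab]
    field_simp; ring

/-- **The strong-coupling free energy**: `F(strongData) = γ ∫cos dμ + E(μ) = γ²/2 − γ²/4 = γ²/4`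
`= gwStrong γ`. [cite: Johansson1998, Lemma 2.1 (γ ≤ 1)] -/
theorem strongData_freeEnergy {γ : ℝ} (h0 : 0 ≤ γ) (h1 : γ ≤ 1) :
    (strongData h0 h1).freeEnergy = gwStrong γ := by
  have hab : |γ / (2 * π)| ≤ 1 / (2 * π) := by
    rw [abs_of_nonneg (by positivity)]
    exact div_le_div_of_nonneg_right h1 (by positivity)
  rw [GWFrostmanData.freeEnergy, gwStrong]
  show γ * ∫ t, Real.cos t ∂(trigMeasure (1 / (2 * π)) (γ / (2 * π))) +
    circleLogEnergy (trigMeasure (1 / (2 * π)) (γ / (2 * π))) = γ ^ 2 / 4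
  rw [integral_cos_trigMeasure hab, circleLogEnergy_trigMeasure hab]
  field_simp; ring

/-! ### The weak-coupling phase `γ > 1`: the gapped Gross–Witten measure as a pull-back

For `γ > 1` the equilibrium measure is Johansson's Lemma 3.2 (ii) density
`π⁻¹ γ cos(t/2) √(1/γ − sin²(t/2))` on the arc `|t| ≤ t_c`, `sin²(t_c/2) = 1/γ`. We never write this
density: under the substitution `sin (t/2) = a sin (β/2)`, `a = γ^{-1/2}`, i.e. `t = T(β)` with
`T(β) = 2 arcsin (a sin (β/2))`, it becomes the CRITICAL density `(2π)⁻¹(1 + cos β) dβ` on the whole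
circle, and `cos T(β) = 1 − a² + a² cos β`. So we DEFINE the weak-coupling measure as the push-forward
`T_* ((2π)⁻¹(1 + cos β) dβ)` and compute everything on the `β`-side, where the symmetrised kernel
`ℓ(t − T β) + ℓ(t + T β) = log (2|cos t − cos T β|) = log (2a²|cos β − c|)`,
`c = 1 + γ(cos t − 1)`, has an explicit integral against `1 + cos β` (`−c` up to constants for
`|c| ≤ 1`, by the Fourier moments of `ℓ`; the Joukowski form for `c < −1`). -/

section Weak

variable {γ : ℝ}

/-- The gap parameter `a = γ^{-1/2}` (`sin² (t_c/2) = a² = 1/γ`). [cite: Johansson1998, Lemma 3.2 (ii)] -/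
def gapParam (γ : ℝ) : ℝ := (Real.sqrt γ)⁻¹

/-- `a > 0`. [folklore] -/
theorem gapParam_pos (hγ : 0 < γ) : 0 < gapParam γ := by
  unfold gapParam; exact inv_pos.2 (Real.sqrt_pos.2 hγ)

/-- `a² = 1/γ`. [folklore] -/
theorem gapParam_sq (hγ : 0 < γ) : gapParam γ ^ 2 = γ⁻¹ := by
  unfold gapParam; rw [inv_pow, Real.sq_sqrt hγ.le]

/-- `a² γ = 1`. [folklore] -/
theorem gapParam_sq_mul (hγ : 0 < γ) : gapParam γ ^ 2 * γ = 1 := by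
  rw [gapParam_sq hγ, inv_mul_cancel₀ hγ.ne']

/-- `a < 1` for `γ > 1`. [folklore] -/
theorem gapParam_lt_one (hγ : 1 < γ) : gapParam γ < 1 := by
  unfold gapParam
  rw [inv_lt_one_iff₀]
  right
  rw [show (1 : ℝ) = Real.sqrt 1 by simp]
  exact Real.sqrt_lt_sqrt zero_le_one hγ

/-- `a ≤ 1` for `γ ≥ 1`. [folklore] -/
theorem gapParam_le_one (hγ : 1 ≤ γ) : gapParam γ ≤ 1 := by
  unfold gapParam
  rw [inv_le_one_iff₀]
  right
  rw [show (1 : ℝ) = Real.sqrt 1 by simp]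
  exact Real.sqrt_le_sqrt hγ

/-- `log a² = −log γ`. [folklore] -/
theorem log_gapParam_sq (hγ : 0 < γ) : Real.log (gapParam γ ^ 2) = -Real.log γ := by
  rw [gapParam_sq hγ, Real.log_inv]

/-- The inner argument `a sin (β/2)` stays in `[-a, a] ⊆ (-1, 1)`. [folklore] -/
theorem abs_gapParam_mul_sin_le (hγ : 1 ≤ γ) (β : ℝ) : |gapParam γ * Real.sin (β / 2)| ≤ gapParam γ := by
  rw [abs_mul, abs_of_pos (gapParam_pos (by linarith))]
  exact mul_le_of_le_one_right (gapParam_pos (by linarith)).le (Real.abs_sin_le_one _)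

/-- **The pull-back map** `T(β) = 2 arcsin (a sin (β/2))`, i.e. `sin (T β / 2) = a sin (β/2)`: it maps
the circle `[-π, π]` onto the arc `[-t_c, t_c]` and the critical density onto the gapped one.
[folklore] -/
def gapMap (γ : ℝ) (β : ℝ) : ℝ := 2 * Real.arcsin (gapParam γ * Real.sin (β / 2))

/-- `T` is continuous. [folklore] -/
@[fun_prop] theorem continuous_gapMap (γ : ℝ) : Continuous (gapMap γ) := by
  unfold gapMap; fun_prop

/-- `T` is measurable. [folklore] -/
@[fun_prop] theorem measurable_gapMap (γ : ℝ) : Measurable (gapMap γ) :=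
  (continuous_gapMap γ).measurable

/-- `T` is odd. [folklore] -/
theorem gapMap_neg (γ β : ℝ) : gapMap γ (-β) = -gapMap γ β := by
  unfold gapMap
  rw [neg_div, Real.sin_neg, mul_neg, Real.arcsin_neg]; ring

/-- `T` takes values in `[-π, π]`. [folklore] -/
theorem gapMap_mem_Icc (γ β : ℝ) : gapMap γ β ∈ Icc (-π) π := by
  unfold gapMap
  constructor
  · have := Real.neg_pi_div_two_le_arcsin (gapParam γ * Real.sin (β / 2)); linarith
  · have := Real.arcsin_le_pi_div_two (gapParam γ * Real.sin (β / 2)); linarith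

/-- **`cos T(β) = 1 − a² + a² cos β`** (from `sin (T/2) = a sin (β/2)` and the half-angle formulae).
[folklore] -/
theorem cos_gapMap (hγ : 1 ≤ γ) (β : ℝ) :
    Real.cos (gapMap γ β) = 1 - gapParam γ ^ 2 + gapParam γ ^ 2 * Real.cos β := by
  unfold gapMap
  set x := gapParam γ * Real.sin (β / 2) with hx
  have hxa := abs_gapParam_mul_sin_le hγ β
  rw [← hx] at hxa
  have ha1 := gapParam_le_one hγ
  have hx1 : -1 ≤ x ∧ x ≤ 1 := by
    constructor <;> [have := neg_abs_le x; have := le_abs_self x] <;> linarith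
  rw [Real.cos_two_mul, Real.cos_sq', Real.sin_arcsin hx1.1 hx1.2, hx, mul_pow]
  have hs : Real.sin (β / 2) ^ 2 = 1 - Real.cos (β / 2) ^ 2 := by
    rw [← Real.sin_sq_add_cos_sq (β / 2)]; ring
  have hc : Real.cos (β / 2) ^ 2 = 1 / 2 + Real.cos β / 2 := by
    rw [Real.cos_sq (β / 2)]; ring_nf
  rw [hs, hc]; ring

/-- The derivative of `T`: `T'(β) = a cos (β/2) / √(1 − (a sin (β/2))²)`. [folklore] -/
theorem hasDerivAt_gapMap (hγ : 1 < γ) (β : ℝ) :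
    HasDerivAt (gapMap γ)
      (gapParam γ * Real.cos (β / 2) / Real.sqrt (1 - (gapParam γ * Real.sin (β / 2)) ^ 2)) β := by
  have ha := gapParam_lt_one hγ
  have hxa := abs_gapParam_mul_sin_le hγ.le β
  have hx1 : gapParam γ * Real.sin (β / 2) ≠ -1 := by
    intro h; rw [h] at hxa; norm_num at hxa; linarith
  have hx2 : gapParam γ * Real.sin (β / 2) ≠ 1 := by
    intro h; rw [h] at hxa; norm_num at hxa; linarith
  have h1 : HasDerivAt (fun β : ℝ => gapParam γ * Real.sin (β / 2))
      (gapParam γ * (Real.cos (β / 2) * (1 / 2))) β := by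
    have := ((Real.hasDerivAt_sin (β / 2)).comp β ((hasDerivAt_id β).div_const 2)).const_mul
      (gapParam γ)
    simpa using this
  have h2 := ((Real.hasDerivAt_arcsin hx1 hx2).comp β h1).const_mul 2
  unfold gapMap
  refine h2.congr_deriv ?_
  field_simp

/-- `T` is strictly increasing on `[-π, π]` (hence injective there). [folklore] -/
theorem strictMonoOn_gapMap (hγ : 1 ≤ γ) : StrictMonoOn (gapMap γ) (Icc (-π) π) := by
  intro x hx y hy hxy
  have ha := gapParam_pos (show 0 < γ by linarith)
  have h1 : Real.sin (x / 2) < Real.sin (y / 2) :=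
    Real.strictMonoOn_sin ⟨by linarith [hx.1], by linarith [hx.2]⟩ ⟨by linarith [hy.1], by linarith [hy.2]⟩
      (by linarith)
  have h2 : gapParam γ * Real.sin (x / 2) < gapParam γ * Real.sin (y / 2) := mul_lt_mul_of_pos_left h1 ha
  have hbx := abs_gapParam_mul_sin_le hγ x
  have hby := abs_gapParam_mul_sin_le hγ y
  have ha1 := gapParam_le_one hγ
  have h3 := Real.strictMonoOn_arcsin
    ⟨by have := neg_abs_le (gapParam γ * Real.sin (x / 2)); linarith,
     by have := le_abs_self (gapParam γ * Real.sin (x / 2)); linarith⟩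
    ⟨by have := neg_abs_le (gapParam γ * Real.sin (y / 2)); linarith,
     by have := le_abs_self (gapParam γ * Real.sin (y / 2)); linarith⟩ h2
  unfold gapMap; linarith

/-- **The weak-coupling equilibrium measure** `μ* = T_* ((2π)⁻¹(1 + cos β) dβ)` — the Gross–Witten
gapped density `π⁻¹ γ cos(t/2) √(1/γ − sin²(t/2)) χ_{[-t_c,t_c]} dt` written as a push-forward of the
critical density (see the section header). [cite: Johansson1998, Lemma 3.2 (ii)] -/
def weakMeasure (γ : ℝ) : Measure ℝ := (trigMeasure (1 / (2 * π)) (1 / (2 * π))).map (gapMap γ)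

/-- The critical density `(2π)⁻¹(1 + cos)` is a probability density. [folklore] -/
theorem isProbabilityMeasure_critMeasure : IsProbabilityMeasure (trigMeasure (1 / (2 * π)) (1 / (2 * π))) :=
  isProbabilityMeasure_trigMeasure (by rw [abs_of_nonneg (by positivity)])

/-- The critical parameters satisfy `|b| ≤ a`. [folklore] -/
theorem abs_crit_le : |(1 : ℝ) / (2 * π)| ≤ 1 / (2 * π) := by rw [abs_of_nonneg (by positivity)]

/-- `μ*` is a probability measure. [folklore] -/
instance isProbabilityMeasure_weakMeasure (γ : ℝ) : IsProbabilityMeasure (weakMeasure γ) := by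
  haveI := isProbabilityMeasure_critMeasure
  exact Measure.isProbabilityMeasure_map (measurable_gapMap γ).aemeasurable

/-- The critical density as a real function, `w(β) = (2π)⁻¹(1 + cos β)`. [folklore] -/
def critW (β : ℝ) : ℝ := 1 / (2 * π) + 1 / (2 * π) * Real.cos β

/-- `w` is continuous. [folklore] -/
@[fun_prop] theorem continuous_critW : Continuous critW := by unfold critW; fun_prop

/-- `w` is even. [folklore] -/
theorem critW_neg (β : ℝ) : critW (-β) = critW β := by simp [critW, Real.cos_neg]

/-- `w ≥ 0`. [folklore] -/
theorem critW_nonneg (β : ℝ) : 0 ≤ critW β := trigDensity_arg_nonneg abs_crit_le β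

/-- **Integration against `μ*`** = integration of `g ∘ T` against the critical density:
`∫ g dμ* = ∫_{-π}^{π} g(T β) (2π)⁻¹(1 + cos β) dβ` (measurable `g`). [folklore] -/
theorem integral_weakMeasure {g : ℝ → ℝ} (hg : Measurable g) :
    ∫ s, g s ∂(weakMeasure γ) = ∫ β in (-π)..π, g (gapMap γ β) * critW β := by
  rw [weakMeasure, integral_map (measurable_gapMap γ).aemeasurable hg.aestronglyMeasurable,
    integral_trigMeasure abs_crit_le]
  rfl

/-- `∫_{-π}^{π} (p + q cos β)(2π)⁻¹(1 + cos β) dβ = p + q/2`. [folklore] -/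
theorem integral_affine_cos_crit (p q : ℝ) :
    ∫ β in (-π)..π, (p + q * Real.cos β) * critW β = p + q / 2 := by
  have h : ∀ β, (p + q * Real.cos β) * critW β =
      p / (2 * π) + (p + q) / (2 * π) * Real.cos β + q / (2 * π) * Real.cos β ^ 2 := fun β => by
    rw [critW]; ring
  simp_rw [h]
  rw [intervalIntegral.integral_add ((intervalIntegrable_const).add
      (by apply Continuous.intervalIntegrable; fun_prop)) (by apply Continuous.intervalIntegrable; fun_prop),
    intervalIntegral.integral_add intervalIntegrable_const (by apply Continuous.intervalIntegrable; fun_prop),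
    intervalIntegral.integral_const_mul, intervalIntegral.integral_const_mul, integral_cos,
    integral_cos_sq_period, intervalIntegral.integral_const]
  simp only [smul_eq_mul, Real.sin_pi, Real.sin_neg, neg_zero, sub_zero, mul_zero, add_zero]
  field_simp; ring

/-- **First moment of `μ*`**: `∫ cos dμ* = 1 − a²/2 = 1 − 1/(2γ)` — Johansson's `ψ(ξ) = 1 − 1/(2ξ)`,
the weak-coupling plaquette. [cite: Johansson1998, (3.8)] -/
theorem integral_cos_weakMeasure (hγ : 1 ≤ γ) :
    ∫ s, Real.cos s ∂(weakMeasure γ) = 1 - gapParam γ ^ 2 / 2 := by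
  rw [integral_weakMeasure Real.continuous_cos.measurable]
  simp_rw [cos_gapMap hγ]
  have := integral_affine_cos_crit (1 - gapParam γ ^ 2) (gapParam γ ^ 2)
  rw [this]; ring

/-- **Density bound for `μ*`** (change of variables): `μ* ≤ (π a)⁻¹ · vol|[-π,π]` — on `(-π, π)` the
critical density `cos²(β/2)/π` is at most `(π a)⁻¹ T'(β)`, so `μ*(A) = ∫_{T⁻¹A} w ≤ (πa)⁻¹ vol (T (T⁻¹ A))`
by the one-dimensional change-of-variables formula. [folklore] -/
theorem weakMeasure_le_smul (hγ : 1 < γ) :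
    weakMeasure γ ≤ ENNReal.ofReal (1 / (π * gapParam γ)) • volume.restrict (Icc (-π) π) := by
  have ha := gapParam_pos (show 0 < γ by linarith)
  have ha1 := gapParam_lt_one hγ
  have hT : Measurable (gapMap γ) := measurable_gapMap γ
  set M : ℝ := 1 / (π * gapParam γ) with hM
  have hM0 : 0 ≤ M := by positivity
  set T' : ℝ → ℝ := fun β => gapParam γ * Real.cos (β / 2) /
    Real.sqrt (1 - (gapParam γ * Real.sin (β / 2)) ^ 2) with hT'
  rw [Measure.le_iff]
  intro A hA
  rw [weakMeasure, Measure.map_apply hT hA, trigMeasure, withDensity_apply _ (hT hA),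
    Measure.restrict_restrict (hT hA), Measure.smul_apply, Measure.restrict_apply hA, smul_eq_mul]
  set B : Set ℝ := gapMap γ ⁻¹' A ∩ Ioo (-π) π with hB
  have hBm : MeasurableSet B := (hT hA).inter measurableSet_Ioo
  -- the density bound on `(-π, π)`
  have hdens : ∀ β ∈ B, trigDensity (1 / (2 * π)) (1 / (2 * π)) β ≤
      ENNReal.ofReal M * (ENNReal.ofReal |T' β| * 1) := by
    intro β hβ
    have hβ' : β ∈ Ioo (-π) π := hβ.2
    rw [mul_one, ← ENNReal.ofReal_mul hM0, trigDensity]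
    refine ENNReal.ofReal_le_ofReal ?_
    have hc : 0 < Real.cos (β / 2) := Real.cos_pos_of_mem_Ioo ⟨by linarith [hβ'.1], by linarith [hβ'.2]⟩
    have hc1 : Real.cos (β / 2) ≤ 1 := Real.cos_le_one _
    have hxa := abs_gapParam_mul_sin_le hγ.le β
    have hx2 : (gapParam γ * Real.sin (β / 2)) ^ 2 < 1 := by
      have : (gapParam γ * Real.sin (β / 2)) ^ 2 ≤ gapParam γ ^ 2 := by
        rw [← sq_abs]; exact pow_le_pow_left₀ (abs_nonneg _) hxa 2
      nlinarith
    have hs0 : 0 < Real.sqrt (1 - (gapParam γ * Real.sin (β / 2)) ^ 2) := Real.sqrt_pos.2 (by linarith)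
    have hs1 : Real.sqrt (1 - (gapParam γ * Real.sin (β / 2)) ^ 2) ≤ 1 :=
      Real.sqrt_le_one.2 (by nlinarith)
    have hT'pos : 0 < T' β := by rw [hT']; positivity
    rw [abs_of_pos hT'pos, hT', hM]
    have hcos : 1 / (2 * π) + 1 / (2 * π) * Real.cos β = Real.cos (β / 2) ^ 2 / π := by
      rw [Real.cos_sq (β / 2), show 2 * (β / 2) = β by ring]; field_simp
    rw [hcos, div_le_iff₀ Real.pi_pos]
    rw [show 1 / (π * gapParam γ) * (gapParam γ * Real.cos (β / 2) /
        Real.sqrt (1 - (gapParam γ * Real.sin (β / 2)) ^ 2)) * π =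
        Real.cos (β / 2) / Real.sqrt (1 - (gapParam γ * Real.sin (β / 2)) ^ 2) by
      field_simp]
    rw [le_div_iff₀ hs0]
    nlinarith [mul_le_mul (le_refl (Real.cos (β / 2))) hs1 hs0.le hc.le]
  calc ∫⁻ β in gapMap γ ⁻¹' A ∩ Icc (-π) π, trigDensity (1 / (2 * π)) (1 / (2 * π)) β
      = ∫⁻ β in B, trigDensity (1 / (2 * π)) (1 / (2 * π)) β := by
        refine setLIntegral_congr ?_
        exact (ae_eq_refl _).inter (Ioo_ae_eq_Icc (μ := volume)).symm
    _ ≤ ∫⁻ β in B, ENNReal.ofReal M * (ENNReal.ofReal |T' β| * 1) :=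
        setLIntegral_mono (by fun_prop) hdens
    _ = ENNReal.ofReal M * ∫⁻ β in B, ENNReal.ofReal |T' β| * 1 := by
        rw [lintegral_const_mul _ (by fun_prop)]
    _ = ENNReal.ofReal M * ∫⁻ x in gapMap γ '' B, (fun _ => (1 : ℝ≥0∞)) x := by
        rw [lintegral_image_eq_lintegral_abs_deriv_mul hBm
          (fun β _ => (hasDerivAt_gapMap hγ β).hasDerivWithinAt)
          ((strictMonoOn_gapMap hγ.le).injOn.mono (inter_subset_right.trans Ioo_subset_Icc_self))
          fun _ => 1]
    _ = ENNReal.ofReal M * volume (gapMap γ '' B) := by rw [setLIntegral_one]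
    _ ≤ ENNReal.ofReal M * volume (A ∩ Icc (-π) π) := by
        gcongr
        rintro x ⟨β, hβ, rfl⟩
        exact ⟨hβ.1, gapMap_mem_Icc γ β⟩

/-- The effective-potential parameter `c(t) = 1 + γ (cos t − 1)` (so that
`cos t − cos T(β) = a² (c(t) − cos β)`; `|c| ≤ 1` exactly on the support arc `|t| ≤ t_c`). [folklore] -/
def gapC (γ t : ℝ) : ℝ := 1 + γ * (Real.cos t - 1)

/-- `c(t) ≤ 1`. [folklore] -/
theorem gapC_le_one (hγ : 0 ≤ γ) (t : ℝ) : gapC γ t ≤ 1 := by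
  unfold gapC; nlinarith [Real.cos_le_one t]

/-- `cos t − cos T(β) = a² (c(t) − cos β)`. [folklore] -/
theorem cos_sub_cos_gapMap (hγ : 1 ≤ γ) (t β : ℝ) :
    Real.cos t - Real.cos (gapMap γ β) = gapParam γ ^ 2 * (gapC γ t - Real.cos β) := by
  rw [cos_gapMap hγ, gapC]
  have h := gapParam_sq_mul (show 0 < γ by linarith)
  linear_combination (1 - Real.cos t) * h

/-- On the support arc, `c (T β) = cos β`. [folklore] -/
theorem gapC_gapMap (hγ : 1 ≤ γ) (β : ℝ) : gapC γ (gapMap γ β) = Real.cos β := by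
  rw [gapC, cos_gapMap hγ]
  have h := gapParam_sq_mul (show 0 < γ by linarith)
  linear_combination (Real.cos β - 1) * h

/-- The solution set of `cos x = c` is countable. [folklore] -/
theorem countable_setOf_cos_eq (c : ℝ) : {x : ℝ | Real.cos x = c}.Countable := by
  by_cases hc : ∃ x₀, Real.cos x₀ = c
  · obtain ⟨x₀, rfl⟩ := hc
    have : {x : ℝ | Real.cos x = Real.cos x₀} ⊆
        (Set.range fun k : ℤ => x₀ - 2 * k * π) ∪ Set.range fun k : ℤ => 2 * k * π - x₀ := by
      intro x hx
      obtain ⟨k, hk | hk⟩ := Real.cos_eq_cos_iff.1 hx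
      · left; exact ⟨k, by linarith⟩
      · right; exact ⟨k, by linarith⟩
    exact ((Set.countable_range _).union (Set.countable_range _)).mono this
  · have : {x : ℝ | Real.cos x = c} = ∅ := by
      ext x; simp only [mem_setOf_eq, mem_empty_iff_false, iff_false]
      exact fun h => hc ⟨x, h⟩
    rw [this]; exact Set.countable_empty

/-- Lebesgue-a.e. `β` has `cos β ≠ c`. [folklore] -/
theorem ae_cos_ne (c : ℝ) : ∀ᵐ β : ℝ, Real.cos β ≠ c :=
  (countable_setOf_cos_eq c).ae_notMem volume

/-- Integrability of the pulled-back kernel against the critical density: `β ↦ ℓ(t − T β) w(β)` is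
integrable on `[-π, π]` — transported from the `μ*`-integrability of `ℓ(t − ·)` (dominated measure)
through `map` and `withDensity`; no analysis of the critical points of `T` is needed. [folklore] -/
theorem intervalIntegrable_circleLogKernel_sub_gapMap (hγ : 1 < γ) (t : ℝ) :
    IntervalIntegrable (fun β => circleLogKernel (t - gapMap γ β) * critW β) volume (-π) π := by
  have h1 : Integrable (fun s => circleLogKernel (t - s)) (weakMeasure γ) :=
    integrable_circleLogKernel_sub (weakMeasure_le_smul hγ) t
  rw [weakMeasure] at h1
  have h2 := (integrable_map_measure (Measurable.aestronglyMeasurable (by fun_prop))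
    (measurable_gapMap γ).aemeasurable).1 h1
  rw [trigMeasure, integrable_withDensity_iff (measurable_trigDensity _ _)
    (ae_of_all _ fun t => by unfold trigDensity; exact ENNReal.ofReal_lt_top)] at h2
  have h3 : IntegrableOn (fun β => circleLogKernel (t - gapMap γ β) * critW β) (Icc (-π) π) := by
    refine h2.congr (ae_of_all _ fun β => ?_)
    simp only [Function.comp_apply, trigDensity, critW]
    rw [ENNReal.toReal_ofReal (trigDensity_arg_nonneg abs_crit_le β)]
  exact (intervalIntegrable_iff_integrableOn_Icc_of_le (by linarith [Real.pi_pos])).2 h3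

/-- **The symmetrised potential of `μ*`**: for every `t`,
`2 U^{μ*}(t) = ∫_{-π}^{π} log (2a²|cos β − c(t)|) (2π)⁻¹(1 + cos β) dβ` — since `μ*` and the kernel
are even, `U(t) = ∫ ℓ(t − Tβ) w = ∫ ℓ(t + Tβ) w`, and a.e. `ℓ(t−Tβ) + ℓ(t+Tβ) = log (2|cos t − cos Tβ|)`
`= log (2a²|cos β − c|)`. [folklore] -/
theorem two_mul_circleLogPotential_weakMeasure (hγ : 1 < γ) (t : ℝ) :
    2 * circleLogPotential (weakMeasure γ) t =
      ∫ β in (-π)..π, Real.log (2 * gapParam γ ^ 2 * |Real.cos β - gapC γ t|) * critW β := by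
  have ha := gapParam_pos (show 0 < γ by linarith)
  have hU : circleLogPotential (weakMeasure γ) t =
      ∫ β in (-π)..π, circleLogKernel (t - gapMap γ β) * critW β := by
    rw [circleLogPotential, integral_weakMeasure (by fun_prop)]
  have hU' : circleLogPotential (weakMeasure γ) t =
      ∫ β in (-π)..π, circleLogKernel (t + gapMap γ β) * critW β := by
    rw [hU]
    have h := intervalIntegral.integral_comp_neg (a := -π) (b := π)
      (f := fun x => circleLogKernel (t + gapMap γ x) * critW x)
    simp only [neg_neg, gapMap_neg, critW_neg, ← sub_eq_add_neg] at h
    exact h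
  have hi1 := intervalIntegrable_circleLogKernel_sub_gapMap hγ t
  have hi2 : IntervalIntegrable (fun β => circleLogKernel (t + gapMap γ β) * critW β) volume (-π) π := by
    have := intervalIntegrable_circleLogKernel_sub_gapMap hγ (-t)
    refine this.congr fun β _ => ?_
    rw [← circleLogKernel_neg (t + gapMap γ β), neg_add, ← sub_eq_add_neg]
  rw [two_mul]
  nth_rewrite 1 [hU]
  rw [hU', ← intervalIntegral.integral_add hi1 hi2]
  refine intervalIntegral.integral_congr_ae ?_
  filter_upwards [ae_cos_ne (gapC γ t)] with β hβ _
  have hne : Real.cos t ≠ Real.cos (gapMap γ β) := by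
    intro h
    have h2 := cos_sub_cos_gapMap hγ.le t β
    rw [h, sub_self] at h2
    have : gapC γ t - Real.cos β = 0 := by
      rcases mul_eq_zero.1 h2.symm with h3 | h3
      · exact absurd h3 (by positivity)
      · exact h3
    exact hβ (by linarith)
  rw [← add_mul, circleLogKernel_sub_add_circleLogKernel_add hne, cos_sub_cos_gapMap hγ.le t β,
    abs_mul, abs_of_pos (by positivity : 0 < gapParam γ ^ 2), abs_sub_comm]
  ring_nf

/-- **Inside the arc** (`|c| ≤ 1`, `c = cos β₀`):
`∫ log (2a²|cos β − cos β₀|) w dβ = log a² − cos β₀`, from `log (2|cos β − cos β₀|) = ℓ(β−β₀) + ℓ(β+β₀)`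
a.e. and the first Fourier moments of `ℓ` against `1 + cos β` (`integral_circleLogKernel_sub_mul`).
[folklore] -/
theorem integral_log_inside (hγ : 1 < γ) (β₀ : ℝ) :
    ∫ β in (-π)..π, Real.log (2 * gapParam γ ^ 2 * |Real.cos β - Real.cos β₀|) * critW β =
      Real.log (gapParam γ ^ 2) - Real.cos β₀ := by
  have ha := gapParam_pos (show 0 < γ by linarith)
  -- a.e. rewrite of the integrand
  have hae : ∀ᵐ β : ℝ, β ∈ Set.uIoc (-π) π →
      Real.log (2 * gapParam γ ^ 2 * |Real.cos β - Real.cos β₀|) * critW β =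
        Real.log (gapParam γ ^ 2) * critW β + circleLogKernel (β₀ - β) * critW β +
          circleLogKernel (-β₀ - β) * critW β := by
    filter_upwards [ae_cos_ne (Real.cos β₀)] with β hβ _
    have hX : 2 * |Real.cos β - Real.cos β₀| ≠ 0 := by
      have : Real.cos β - Real.cos β₀ ≠ 0 := sub_ne_zero.2 hβ
      positivity
    rw [show 2 * gapParam γ ^ 2 * |Real.cos β - Real.cos β₀| =
        gapParam γ ^ 2 * (2 * |Real.cos β - Real.cos β₀|) by ring,
      Real.log_mul (by positivity) hX, ← circleLogKernel_sub_add_circleLogKernel_add hβ,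
      circleLogKernel_sub_comm β β₀, show β + β₀ = -(-β₀ - β) by ring, circleLogKernel_neg]
    ring
  rw [intervalIntegral.integral_congr_ae hae]
  have hi0 : IntervalIntegrable (fun β => Real.log (gapParam γ ^ 2) * critW β) volume (-π) π :=
    (continuous_critW.intervalIntegrable _ _).const_mul _
  have hi1 : IntervalIntegrable (fun β => circleLogKernel (β₀ - β) * critW β) volume (-π) π :=
    (intervalIntegrable_circleLogKernel_sub' β₀ _ _).mul_continuousOn continuous_critW.continuousOn
  have hi2 : IntervalIntegrable (fun β => circleLogKernel (-β₀ - β) * critW β) volume (-π) π :=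
    (intervalIntegrable_circleLogKernel_sub' (-β₀) _ _).mul_continuousOn continuous_critW.continuousOn
  rw [intervalIntegral.integral_add (hi0.add hi1) hi2, intervalIntegral.integral_add hi0 hi1,
    intervalIntegral.integral_const_mul]
  have h1 : ∫ β in (-π)..π, critW β = 1 := by
    have := integral_affine_cos_crit 1 0
    simp only [zero_mul, add_zero, one_mul, zero_div] at this
    exact this
  have h2 : ∀ u, ∫ β in (-π)..π, circleLogKernel (u - β) * critW β = -(Real.cos u) / 2 := fun u => by
    simp only [critW]
    rw [integral_circleLogKernel_sub_mul]; field_simp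
  rw [h1, h2, h2, Real.cos_neg]; ring

/-- The Joukowski parameter `ρ(C) = C − √(C² − 1)` of `C > 1`: `0 < ρ < 1`, `ρ + ρ⁻¹ = 2C`. [folklore] -/
def joukowskiRho (C : ℝ) : ℝ := C - Real.sqrt (C ^ 2 - 1)

/-- `ρ > 0`. [folklore] -/
theorem joukowskiRho_pos {C : ℝ} (hC : 1 < C) : 0 < joukowskiRho C := by
  unfold joukowskiRho
  have h1 : Real.sqrt (C ^ 2 - 1) < C := by
    calc Real.sqrt (C ^ 2 - 1) < Real.sqrt (C ^ 2) := Real.sqrt_lt_sqrt (by nlinarith) (by linarith)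
      _ = C := Real.sqrt_sq (by linarith)
  linarith

/-- `ρ < 1`. [folklore] -/
theorem joukowskiRho_lt_one {C : ℝ} (hC : 1 < C) : joukowskiRho C < 1 := by
  unfold joukowskiRho
  have h1 : C - 1 < Real.sqrt (C ^ 2 - 1) := by
    rw [show C - 1 = Real.sqrt ((C - 1) ^ 2) by rw [Real.sqrt_sq (by linarith)]]
    exact Real.sqrt_lt_sqrt (by positivity) (by nlinarith)
  linarith

/-- `ρ (C + √(C²−1)) = 1`. [folklore] -/
theorem joukowskiRho_mul_inv {C : ℝ} (hC : 1 < C) :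
    joukowskiRho C * (C + Real.sqrt (C ^ 2 - 1)) = 1 := by
  unfold joukowskiRho
  have h := Real.sq_sqrt (show (0 : ℝ) ≤ C ^ 2 - 1 by nlinarith)
  nlinarith [h]

/-- `ρ⁻¹ = C + √(C²−1)`. [folklore] -/
theorem joukowskiRho_inv {C : ℝ} (hC : 1 < C) : (joukowskiRho C)⁻¹ = C + Real.sqrt (C ^ 2 - 1) := by
  have h := joukowskiRho_mul_inv hC
  have h0 := (joukowskiRho_pos hC).ne'
  field_simp
  linarith

/-- `(ρ + ρ⁻¹)/2 = C`. [folklore] -/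
theorem joukowskiRho_add_inv {C : ℝ} (hC : 1 < C) :
    (joukowskiRho C + (joukowskiRho C)⁻¹) / 2 = C := by
  rw [joukowskiRho_inv hC]; unfold joukowskiRho; ring

/-- **Outside the arc** (`c < −1`, `C = −c = (ρ + ρ⁻¹)/2`):
`∫ log (2a²|cos β − c|) w dβ = log a² + ρ − log ρ`, from the Joukowski form
`log (C + cos β) = 2 ℓ_ρ(β + π) − log (2ρ)` and the first Fourier moments of `ℓ_ρ`. [folklore] -/
theorem integral_log_outside (hγ : 1 < γ) {c : ℝ} (hc : c < -1) :
    ∫ β in (-π)..π, Real.log (2 * gapParam γ ^ 2 * |Real.cos β - c|) * critW β =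
      Real.log (gapParam γ ^ 2) + joukowskiRho (-c) - Real.log (joukowskiRho (-c)) := by
  have ha := gapParam_pos (show 0 < γ by linarith)
  have hC1 : 1 < -c := by linarith
  set ρ := joukowskiRho (-c) with hρ
  have hρ0 := joukowskiRho_pos hC1
  have hρ1 := joukowskiRho_lt_one hC1
  have hsum := joukowskiRho_add_inv hC1
  rw [← hρ] at hρ0 hρ1 hsum
  have hpt : ∀ β, Real.log (2 * gapParam γ ^ 2 * |Real.cos β - c|) * critW β =
      (Real.log (2 * gapParam γ ^ 2) - Real.log (2 * ρ)) * critW β +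
        2 * (circleLogKernelR ρ (-π - β) * critW β) := by
    intro β
    have hpos : 0 < Real.cos β - c := by linarith [Real.neg_one_le_cos β]
    rw [abs_of_pos hpos, Real.log_mul (by positivity) hpos.ne',
      show Real.cos β - c = (ρ + ρ⁻¹) / 2 + Real.cos β by rw [hsum]; ring,
      log_joukowski_add_cos hρ0 hρ1, ← circleLogKernelR_neg ρ (β + π), show -(β + π) = -π - β by ring]
    ring
  simp_rw [hpt]
  have hi0 : IntervalIntegrable (fun β => (Real.log (2 * gapParam γ ^ 2) - Real.log (2 * ρ)) * critW β)
      volume (-π) π := (continuous_critW.intervalIntegrable _ _).const_mul _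
  have hi1 : IntervalIntegrable (fun β => 2 * (circleLogKernelR ρ (-π - β) * critW β)) volume (-π) π :=
    ((((continuous_circleLogKernelR hρ0.le hρ1).comp (by fun_prop : Continuous fun β : ℝ => -π - β)).mul
      continuous_critW).intervalIntegrable _ _).const_mul _
  rw [intervalIntegral.integral_add hi0 hi1, intervalIntegral.integral_const_mul,
    intervalIntegral.integral_const_mul]
  have h1 : ∫ β in (-π)..π, critW β = 1 := by
    have := integral_affine_cos_crit 1 0
    simp only [zero_mul, add_zero, one_mul, zero_div] at this
    exact this
  have h2 : ∫ β in (-π)..π, circleLogKernelR ρ (-π - β) * critW β = ρ / 2 := by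
    simp only [critW]
    rw [integral_circleLogKernelR_sub_mul hρ0.le hρ1, Real.cos_neg, Real.cos_pi]; field_simp
  rw [h1, h2, Real.log_mul (by positivity) (by positivity), Real.log_mul (by positivity) hρ0.ne']
  ring

/-- The Frostman constant of the weak phase, `ℓ_F = γ − 1 − log γ`. [folklore] -/
def weakFrostmanConst (γ : ℝ) : ℝ := γ - 1 - Real.log γ

/-- **Frostman EQUALITY on the arc**: if `|c(t)| ≤ 1` then `γ cos t + 2U^{μ*}(t) = γ − 1 − log γ`.
[folklore] -/
theorem frostman_eq_inside (hγ : 1 < γ) {t : ℝ} (hc : -1 ≤ gapC γ t) :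
    γ * Real.cos t + 2 * circleLogPotential (weakMeasure γ) t = weakFrostmanConst γ := by
  have hc1 := gapC_le_one (show 0 ≤ γ by linarith) t
  rw [two_mul_circleLogPotential_weakMeasure hγ t, ← Real.cos_arccos hc hc1,
    integral_log_inside hγ (Real.arccos (gapC γ t)), Real.cos_arccos hc hc1,
    log_gapParam_sq (by linarith), weakFrostmanConst, gapC]
  ring

/-- **Frostman INEQUALITY off the arc**: if `c(t) < −1` then
`γ cos t + 2U^{μ*}(t) = ℓ_F + (ρ/2 − ρ⁻¹/2 − log ρ) ≤ ℓ_F` (as `x ≤ sinh x` for `x = log ρ⁻¹ ≥ 0`).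
[folklore] -/
theorem frostman_le_outside (hγ : 1 < γ) {t : ℝ} (hc : gapC γ t < -1) :
    γ * Real.cos t + 2 * circleLogPotential (weakMeasure γ) t ≤ weakFrostmanConst γ := by
  have hC1 : 1 < -gapC γ t := by linarith
  set ρ := joukowskiRho (-gapC γ t) with hρ
  have hρ0 := joukowskiRho_pos hC1
  have hρ1 := joukowskiRho_lt_one hC1
  have hsum := joukowskiRho_add_inv hC1
  rw [← hρ] at hρ0 hρ1 hsum
  rw [two_mul_circleLogPotential_weakMeasure hγ t, integral_log_outside hγ hc, ← hρ,
    log_gapParam_sq (by linarith), weakFrostmanConst]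
  have hcos : γ * Real.cos t = γ - 1 + gapC γ t := by rw [gapC]; ring
  rw [hcos]
  -- `-C + ρ - log ρ ≤ 0` with `C = (ρ + ρ⁻¹)/2`: `x ≤ sinh x` for `x = -log ρ ≥ 0`
  have hx : -Real.log ρ ≤ Real.sinh (-Real.log ρ) :=
    Real.self_le_sinh_iff.2 (by rw [neg_nonneg]; exact Real.log_nonpos hρ0.le hρ1.le)
  rw [Real.sinh_eq, neg_neg, Real.exp_neg, Real.exp_log hρ0] at hx
  have hC : gapC γ t = -((ρ + ρ⁻¹) / 2) := by linarith
  rw [hC]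
  linarith

/-- **Frostman inequality for `μ*`**, all `t`: `γ cos t + 2U^{μ*}(t) ≤ γ − 1 − log γ`. [folklore] -/
theorem frostman_le_weak (hγ : 1 < γ) (t : ℝ) :
    γ * Real.cos t + 2 * circleLogPotential (weakMeasure γ) t ≤ weakFrostmanConst γ := by
  rcases lt_or_ge (gapC γ t) (-1) with h | h
  · exact frostman_le_outside hγ h
  · exact (frostman_eq_inside hγ h).le

/-- The potential of `μ*` ON the arc, in the `β`-variable: `2 U^{μ*}(T β) = log a² − cos β`. [folklore] -/
theorem two_mul_circleLogPotential_weakMeasure_gapMap (hγ : 1 < γ) (β : ℝ) :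
    2 * circleLogPotential (weakMeasure γ) (gapMap γ β) = Real.log (gapParam γ ^ 2) - Real.cos β := by
  have h := frostman_eq_inside hγ (t := gapMap γ β)
    (by rw [gapC_gapMap hγ.le]; exact Real.neg_one_le_cos β)
  rw [weakFrostmanConst, cos_gapMap hγ.le] at h
  rw [log_gapParam_sq (by linarith)]
  have h2 := gapParam_sq_mul (show 0 < γ by linarith)
  have h3 : γ * (1 - gapParam γ ^ 2 + gapParam γ ^ 2 * Real.cos β) = γ - 1 + Real.cos β := by
    linear_combination (Real.cos β - 1) * h2
  linarith

/-- **Energy of `μ*`**: `2 E(μ*) = log a² − 1/2`. [folklore] -/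
theorem two_mul_circleLogEnergy_weakMeasure (hγ : 1 < γ) :
    2 * circleLogEnergy (weakMeasure γ) = Real.log (gapParam γ ^ 2) - 1 / 2 := by
  rw [circleLogEnergy, ← MeasureTheory.integral_const_mul,
    integral_weakMeasure ((measurable_circleLogPotential (μ := weakMeasure γ)).const_mul 2)]
  simp_rw [two_mul_circleLogPotential_weakMeasure_gapMap hγ]
  have := integral_affine_cos_crit (Real.log (gapParam γ ^ 2)) (-1)
  simp only [neg_mul, one_mul, ← sub_eq_add_neg] at this
  rw [this]; ring

/-- **Frostman data in the weak-coupling phase** `γ > 1`: the pushed-forward critical density `μ*`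
(= the Gross–Witten gapped measure), density bound `(π a)⁻¹ = √γ/π`, Frostman constant
`ℓ_F = γ − 1 − log γ` (equality on the arc `[-t_c, t_c]`, strict inequality off it).
[cite: Johansson1998, Lemma 3.2 (ii)] -/
def weakData (hγ : 1 < γ) : GWFrostmanData γ where
  μ := weakMeasure γ
  isProb := isProbabilityMeasure_weakMeasure γ
  M := 1 / (π * gapParam γ)
  le_smul := weakMeasure_le_smul hγ
  ℓF := weakFrostmanConst γ
  frostman_le := frostman_le_weak hγ
  frostman_eq := by
    have h1 := integral_cos_weakMeasure hγ.le
    have h2 := two_mul_circleLogEnergy_weakMeasure hγ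
    have h3 := gapParam_sq_mul (show 0 < γ by linarith)
    rw [log_gapParam_sq (by linarith)] at h2
    rw [h1, weakFrostmanConst]
    have h4 : γ * (1 - gapParam γ ^ 2 / 2) = γ - 1 / 2 := by linear_combination (-1 / 2 : ℝ) * h3
    linarith

/-- **The weak-coupling free energy**: `F(weakData) = γ(1 − 1/(2γ)) + (−log γ − 1/2)/2`
`= γ − 3/4 − (log γ)/2 = gwWeak γ`. [cite: Johansson1998, Lemma 2.1 (γ > 1)] -/
theorem weakData_freeEnergy (hγ : 1 < γ) : (weakData hγ).freeEnergy = gwWeak γ := by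
  have h1 := integral_cos_weakMeasure hγ.le
  have h2 := two_mul_circleLogEnergy_weakMeasure hγ
  have h3 := gapParam_sq_mul (show 0 < γ by linarith)
  rw [log_gapParam_sq (by linarith)] at h2
  rw [GWFrostmanData.freeEnergy, gwWeak]
  show γ * ∫ t, Real.cos t ∂(weakMeasure γ) + circleLogEnergy (weakMeasure γ) = γ - 3 / 4 - Real.log γ / 2
  rw [h1]
  have h4 : γ * (1 - gapParam γ ^ 2 / 2) = γ - 1 / 2 := by linear_combination (-1 / 2 : ℝ) * h3
  linarith

end Weak

end Literature.Barriers.QuantumFields
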